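import Summits.QuantumFields.YangMills.Theorems.BalabanUVNodesN16PinnedLayer13CoPH
import Literature.MathematicalPhysics.QuantumFieldTheory.Balaban1983to89.Node00.Record13CoPHChi
import Summits.QuantumFields.YangMills.Theorems.BalabanUVNodesRateCarriersOfRecord13CoPHCmap

/-!
# Route «BalabanUVNodes», crux K3ᴬ `SpineGivenEndpointR13SepCoPHVAx` (stmt-QuantumFields-27247) — node N16 = NE3: THE N16 PIN LAYER OF A STAGE-13 RATE READING,
# RE-ISSUED CENTRE-MAP-GENERIC («Cmap») WITH THE RE-CENTRED («Ax») INSTANCES — op 5c supply row R12 (plan g99 `D99-KAX/OP5C-SUPPLY-CENSUS-K3v8.md` §2 row 12)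

Cell `pub-ymgap`, seat `pub-ymgap-dag-n16-e` (R134 (a), s2), generation 30.  `--supports stmt-QuantumFields-27247 --as helper` (count-neutral).  NEW basename beside the
UNTOUCHED parent module 43 `Thm/BalabanUVNodesN16PinnedLayer13CoPH` (✓p600861); the [Ax-3c]∕[Ax-3d] pattern of `Node00/Record13CoPHChi`: every declaration below is the
VERBATIM body of the like-named declaration of the parent (§1–§3, the READING-BOUND api) with exactly the substitutions
`(𝔯 : RateReading₁₃CoPH N) ↦ (𝔯 : RateReading₁₃CoPHCmap N Χ)`, binder `(hP : θ.Provisos₁₃CoPH F N) ↦ (hP : θ.Provisos₁₃CoPHChi F N (Χ F θ.toStage13Params))`,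
`rateCarriersOfRecord₁₃CoPH ↦ rateCarriersOfRecord₁₃CoPHCmap`, names `X ↦ XCmap` (defs) ∕ `…Cmap…` (theorems); the Ax instances `XAx := XCmap (fun F => chiβOfRecord₁₃Ax F N)`
are `abbrev`s.  The READING-FREE declarations of the parent (`N16LettersEnd`, `inEndRegimeH_loose_iff`, `n16HolderAt_of_dom_eq_empty`) and `K3V5Defs.N16RadiusMatch` are
NOT re-declared — they are cited by name at the Ax world unchanged.

WHY (director-ym №462∕№467∕№477, RESTATE V1′ rev 31–33; dag-lead g40 HANDS-4 R12).  K3ᴬ's text binds `(h : θ.Provisos₁₃SepCoPHAx F 2)`; the K3 v7 skeleton's guard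
`GuardedReadingN16 𝔯 ksel ℓ ℓ₃ g B := GuardedReading 𝔯 ksel ℓ ∧ N16PinnedLoose 𝔯 ℓ₃ B ∧ N16LettersEnd 2 g ℓ₃ ∧ N16RadiusMatch ℓ₃ B` reads node N16's pin at a reading typed
over `θ.Provisos₁₃CoPH`; the v8 skeleton over the Ax reading tower needs `N16PinnedLoose` at `(𝔯 : RateReading₁₃CoPHAx N)` — §1's `N16PinnedLooseAx`.  N16's share is
CENTRE-BLIND (this seat's LOCATED, pub-ymgap INBOX l.21677): the pinned NE3 layer is θ-free and the N16 conjunct reads the provisos only as the inhabitation premise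
`(∃ θ, θ.Provisos₁₃CoPHChi F N (Χ F θ.toStage13Params)) →` (§2), so every N16 producer of the parent's §4 transfers by `n16HolderAtReadingCmap_of_pinnedLoose` with its
letters unchanged.

CONTENTS.  §1 `N16PinnedConstCmap` · `N16PinnedLooseCmap` · `N16HolderAtReadingCmap` (+ `…Ax` abbrevs).  §2 faces: `rateCarriersCmap_ne3_of_pinnedConst∕Loose`,
`n16HolderAtReadingCmap_iff_of_pinnedConst∕Loose`, `n16HolderAtReadingCmap_of_pinnedConst∕Loose`.  §3 `eraseNE3Cmap` + `rfl` faces + `n16HolderAtReadingCmap_eraseNE3`,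
`ratesHolderAt_rateCarriersCmap_eraseNE3_iff`, `not_n16PinnedConstCmap_eraseNE3`, `not_n16PinnedLooseCmap_eraseNE3_of_nonempty`.
HONEST FRAMING.  Definitions re-issued over a parameter + kernel bookkeeping; no estimate; nothing of Bałaban asserted; N16 ∕ NE3 NOT discharged; K3ᴬ OPEN (skeleton
unregistered at filing); counts UNMOVED (typed 28∕28 · discharged 8∕27, A 8∕28); no `sorry`∕`instance`∕`notation`; standard axioms; one finite four-torus at fixed ε — NOT
ℝ⁴ ∕ infinite volume ∕ OS ∕ mass gap ∕ Clay.
-/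

set_option autoImplicit false

noncomputable section

open scoped BigOperators Matrix Matrix.Norms.L2Operator

namespace Summit.QuantumFields.YangMills.BalabanUVNodes.N16PinnedLayer13CoPH

open Literature.MathematicalPhysics.QuantumFieldTheory.Balaban1983to89
open Literature.MathematicalPhysics.QuantumFieldTheory.Balaban1983to89.T4Continuum (T4Family ULoop)
open Node00 (Stage13Params Stage13HParams ChiSlot chiβOfRecord₁₃Ax NE3Objects₁₁ NE3Letters₁₁ ne3ConstLayerOfRecord₁₁ ne3NperOfRecord₁₁ ne3DomOfRecord₁₁
  populated_ne3ConstLayerOfRecord₁₁ MatA)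
open Summit.QuantumFields.BalabanUV.T4Continuum
open MinimalActionRate (sfClass)
open YMDAG.UVSplit (Datum NE3Carriers NE1pCarriers RateCarriers N14At N15At N17At N18At N22At ne3OfRecord₁₁ RateReading₁₃CoPHCmap RateReading₁₃CoPHAx
  rateCarriersOfRecord₁₃CoPHCmap)
open Summit.QuantumFields.YangMills.BalabanUVNodes.N16HolderDefs (N16HolderAt)
open Summit.QuantumFields.YangMills.BalabanUVNodes.SpineRatesHolder (RatesHolderAt)

variable {N : ℕ} [NeZero N] {Χ : (F : T4Family) → Stage13Params F N → ChiSlot F N}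

/-! ## §1 The two N16 pins and the N16 conjunct at a centre-map-generic reading; the Ax instances -/

/-- **THE N16 PIN — ALL DATA OF RECORD, at a centre-map-generic reading**: VERBATIM `N16PinnedConst` over `RateReading₁₃CoPHCmap N Χ`. [folklore] -/
@[folklore]
def N16PinnedConstCmap (𝔯 : RateReading₁₃CoPHCmap N Χ) (ℓ₃ : T4Family → NE3Letters₁₁) : Prop :=
  ∀ (F : T4Family) (θ : Stage13HParams F N) (hP : θ.Provisos₁₃CoPHChi F N (Χ F θ.toStage13Params)) (g₀ : ℕ → ℝ) (os : List (ULoop F)) (k : ℕ),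
    (𝔯.lit F θ hP g₀ os).ne3 k = ne3ConstLayerOfRecord₁₁ F N (ℓ₃ F)

/-- **THE N16 PIN — (C1)(i) LOOSE EDITION, at a centre-map-generic reading**: VERBATIM `N16PinnedLoose` over `RateReading₁₃CoPHCmap N Χ` — the K3 skeleton's use-site
(`GuardedReadingN16`). [cite: Balaban1985Variational, Thm 1 (7) p.279] [folklore] -/
@[folklore]
def N16PinnedLooseCmap (𝔯 : RateReading₁₃CoPHCmap N Χ) (ℓ₃ : T4Family → NE3Letters₁₁) (B : T4Family → ℝ) : Prop :=
  ∀ (F : T4Family) (θ : Stage13HParams F N) (hP : θ.Provisos₁₃CoPHChi F N (Χ F θ.toStage13Params)) (g₀ : ℕ → ℝ) (os : List (ULoop F)) (k : ℕ),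
    (𝔯.lit F θ hP g₀ os).ne3 k =
      { ne3ConstLayerOfRecord₁₁ F N (ℓ₃ F) with
        dom := {V | V ∈ ne3DomOfRecord₁₁ F N 0 0 ∧ V ∈ sfClass 4 F.L (ne3NperOfRecord₁₁ F 0 0) ((ℓ₃ F).ε / B F) 0} }

/-- **THE N16 CONJUNCT AT A CENTRE-MAP-GENERIC READING**: VERBATIM `N16HolderAtReading` over `RateReading₁₃CoPHCmap N Χ`. [folklore] -/
@[folklore]
def N16HolderAtReadingCmap (𝔯 : RateReading₁₃CoPHCmap N Χ) (β : ℝ) : Prop :=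
  ∀ (F : T4Family) (θ : Stage13HParams F N) (hP : θ.Provisos₁₃CoPHChi F N (Χ F θ.toStage13Params)) (g₀ : ℕ → ℝ) (os : List (ULoop F)) (k : ℕ),
    N16HolderAt (rateCarriersOfRecord₁₃CoPHCmap 𝔯 F θ hP g₀ os k).ne3 β

/-- **The const pin at the RE-CENTRED reading** (instance `Χ := chiβOfRecord₁₃Ax`). [folklore] -/
abbrev N16PinnedConstAx (𝔯 : RateReading₁₃CoPHAx N) (ℓ₃ : T4Family → NE3Letters₁₁) : Prop := N16PinnedConstCmap 𝔯 ℓ₃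

/-- **The loose pin at the RE-CENTRED reading** (instance `Χ := chiβOfRecord₁₃Ax`) — what the K3ᴬ skeleton's `GuardedReadingN16` reads. [folklore] -/
abbrev N16PinnedLooseAx (𝔯 : RateReading₁₃CoPHAx N) (ℓ₃ : T4Family → NE3Letters₁₁) (B : T4Family → ℝ) : Prop := N16PinnedLooseCmap 𝔯 ℓ₃ B

/-- **The N16 conjunct at the RE-CENTRED reading** (instance `Χ := chiβOfRecord₁₃Ax`). [folklore] -/
abbrev N16HolderAtReadingAx (𝔯 : RateReading₁₃CoPHAx N) (β : ℝ) : Prop := N16HolderAtReadingCmap 𝔯 β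

/-! ## §2 Faces: under either pin the bundle's NE3 component is RR-1's object BY NAME; the conjunct is ONE tuple-free sentence per family -/

section Faces

variable {𝔯 : RateReading₁₃CoPHCmap N Χ} {ℓ₃ : T4Family → NE3Letters₁₁} {B : T4Family → ℝ} (β : ℝ)

/-- Under the const pin the bundle's NE3 component IS RR-1's object of record. [folklore] -/
theorem rateCarriersCmap_ne3_of_pinnedConst (h : N16PinnedConstCmap 𝔯 ℓ₃) (F : T4Family) (θ : Stage13HParams F N)
    (hP : θ.Provisos₁₃CoPHChi F N (Χ F θ.toStage13Params)) (g₀ : ℕ → ℝ) (os : List (ULoop F)) (k : ℕ) :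
    (rateCarriersOfRecord₁₃CoPHCmap 𝔯 F θ hP g₀ os k).ne3 = ne3OfRecord₁₁ F (ne3ConstLayerOfRecord₁₁ F N (ℓ₃ F)) := by
  show ne3OfRecord₁₁ F ((𝔯.lit F θ hP g₀ os).ne3 k) = _
  rw [h]

/-- Under the loose pin the bundle's NE3 component IS the loose-data object. [folklore] -/
theorem rateCarriersCmap_ne3_of_pinnedLoose (h : N16PinnedLooseCmap 𝔯 ℓ₃ B) (F : T4Family) (θ : Stage13HParams F N)
    (hP : θ.Provisos₁₃CoPHChi F N (Χ F θ.toStage13Params)) (g₀ : ℕ → ℝ) (os : List (ULoop F)) (k : ℕ) :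
    (rateCarriersOfRecord₁₃CoPHCmap 𝔯 F θ hP g₀ os k).ne3 =
      ne3OfRecord₁₁ F { ne3ConstLayerOfRecord₁₁ F N (ℓ₃ F) with
        dom := {V | V ∈ ne3DomOfRecord₁₁ F N 0 0 ∧ V ∈ sfClass 4 F.L (ne3NperOfRecord₁₁ F 0 0) ((ℓ₃ F).ε / B F) 0} } := by
  show ne3OfRecord₁₁ F ((𝔯.lit F θ hP g₀ os).ne3 k) = _
  rw [h]

/-- **★ UNDER THE CONST PIN THE N16 CONJUNCT AT THE READING IS ONE TUPLE-FREE SENTENCE PER FAMILY** — the provisos enter only as the inhabitation premise. [folklore] -/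
theorem n16HolderAtReadingCmap_iff_of_pinnedConst (h : N16PinnedConstCmap 𝔯 ℓ₃) :
    N16HolderAtReadingCmap 𝔯 β ↔ ∀ F : T4Family, (∃ θ : Stage13HParams F N, θ.Provisos₁₃CoPHChi F N (Χ F θ.toStage13Params)) →
      N16HolderAt (ne3OfRecord₁₁ F (ne3ConstLayerOfRecord₁₁ F N (ℓ₃ F))) β := by
  constructor
  · rintro H F ⟨θ, hP⟩
    rw [← rateCarriersCmap_ne3_of_pinnedConst h F θ hP (fun _ => 0) [] 0]
    exact H F θ hP (fun _ => 0) [] 0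
  · intro H F θ hP g₀ os k
    rw [rateCarriersCmap_ne3_of_pinnedConst h F θ hP g₀ os k]
    exact H F ⟨θ, hP⟩

/-- … in particular (premise-free producers transfer). [folklore] -/
theorem n16HolderAtReadingCmap_of_pinnedConst (h : N16PinnedConstCmap 𝔯 ℓ₃)
    (H : ∀ F : T4Family, N16HolderAt (ne3OfRecord₁₁ F (ne3ConstLayerOfRecord₁₁ F N (ℓ₃ F))) β) : N16HolderAtReadingCmap 𝔯 β :=
  (n16HolderAtReadingCmap_iff_of_pinnedConst β h).2 fun F _ => H F

/-- **★ THE SAME UNDER THE LOOSE PIN**, at the loose-data object. [folklore] -/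
theorem n16HolderAtReadingCmap_iff_of_pinnedLoose (h : N16PinnedLooseCmap 𝔯 ℓ₃ B) :
    N16HolderAtReadingCmap 𝔯 β ↔ ∀ F : T4Family, (∃ θ : Stage13HParams F N, θ.Provisos₁₃CoPHChi F N (Χ F θ.toStage13Params)) →
      N16HolderAt (ne3OfRecord₁₁ F { ne3ConstLayerOfRecord₁₁ F N (ℓ₃ F) with
        dom := {V | V ∈ ne3DomOfRecord₁₁ F N 0 0 ∧ V ∈ sfClass 4 F.L (ne3NperOfRecord₁₁ F 0 0) ((ℓ₃ F).ε / B F) 0} }) β := by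
  constructor
  · rintro H F ⟨θ, hP⟩
    rw [← rateCarriersCmap_ne3_of_pinnedLoose h F θ hP (fun _ => 0) [] 0]
    exact H F θ hP (fun _ => 0) [] 0
  · intro H F θ hP g₀ os k
    rw [rateCarriersCmap_ne3_of_pinnedLoose h F θ hP g₀ os k]
    exact H F ⟨θ, hP⟩

/-- … in particular (premise-free producers transfer: the parent's §4 letters serve the Ax world unchanged). [folklore] -/
theorem n16HolderAtReadingCmap_of_pinnedLoose (h : N16PinnedLooseCmap 𝔯 ℓ₃ B)
    (H : ∀ F : T4Family, N16HolderAt (ne3OfRecord₁₁ F { ne3ConstLayerOfRecord₁₁ F N (ℓ₃ F) with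
      dom := {V | V ∈ ne3DomOfRecord₁₁ F N 0 0 ∧ V ∈ sfClass 4 F.L (ne3NperOfRecord₁₁ F 0 0) ((ℓ₃ F).ε / B F) 0} }) β) :
    N16HolderAtReadingCmap 𝔯 β :=
  (n16HolderAtReadingCmap_iff_of_pinnedLoose β h).2 fun F _ => H F

end Faces

/-! ## §3 The vacuity witness at a centre-map-generic reading: the NE3-ERASED reading -/

/-- **THE NE3-ERASED READING** (centre-map-generic): `u3 ∕ ne2 ∕ ne1` are `𝔯`'s; N16's layer := the NE3 object with all letters `0` and NO data. [folklore] -/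
@[folklore]
def eraseNE3Cmap (𝔯 : RateReading₁₃CoPHCmap N Χ) : RateReading₁₃CoPHCmap N Χ :=
  ⟨fun F θ hP g₀ os => { 𝔯.lit F θ hP g₀ os with ne3 := fun _ => ⟨0, 0, 0, 0, 0, 0, 0, ∅⟩ }, 𝔯.ne1⟩

/-- The same at the RE-CENTRED reading. [folklore] -/
abbrev eraseNE3Ax (𝔯 : RateReading₁₃CoPHAx N) : RateReading₁₃CoPHAx N := eraseNE3Cmap 𝔯

section Erase

variable (𝔯 : RateReading₁₃CoPHCmap N Χ) {F : T4Family} (θ : Stage13HParams F N) (hP : θ.Provisos₁₃CoPHChi F N (Χ F θ.toStage13Params)) (g₀ : ℕ → ℝ)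
  (os : List (ULoop F)) (k : ℕ)

/-- Face (`rfl`): its dressed tower is `𝔯`'s. [folklore] -/
theorem eraseNE3Cmap_ne1 : (eraseNE3Cmap 𝔯).ne1 F θ hP g₀ os = 𝔯.ne1 F θ hP g₀ os := rfl

/-- Face (`rfl`): its node-U3 objects are `𝔯`'s. [folklore] -/
theorem eraseNE3Cmap_lit_u3 : ((eraseNE3Cmap 𝔯).lit F θ hP g₀ os).u3 = (𝔯.lit F θ hP g₀ os).u3 := rfl

/-- Face (`rfl`): its N15 layers are `𝔯`'s. [folklore] -/
theorem eraseNE3Cmap_lit_ne2 : ((eraseNE3Cmap 𝔯).lit F θ hP g₀ os).ne2 k = (𝔯.lit F θ hP g₀ os).ne2 k := rfl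

/-- Face (`rfl`) at the bundle: `ne1` unchanged. [folklore] -/
theorem rateCarriersCmap_eraseNE3_ne1 :
    (rateCarriersOfRecord₁₃CoPHCmap (eraseNE3Cmap 𝔯) F θ hP g₀ os k).ne1 = (rateCarriersOfRecord₁₃CoPHCmap 𝔯 F θ hP g₀ os k).ne1 := rfl

/-- Face (`rfl`) at the bundle: `ne2` unchanged. [folklore] -/
theorem rateCarriersCmap_eraseNE3_ne2 :
    (rateCarriersOfRecord₁₃CoPHCmap (eraseNE3Cmap 𝔯) F θ hP g₀ os k).ne2 = (rateCarriersOfRecord₁₃CoPHCmap 𝔯 F θ hP g₀ os k).ne2 := rfl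

/-- Face (`rfl`) at the bundle: `u3` unchanged. [folklore] -/
theorem rateCarriersCmap_eraseNE3_u3 :
    (rateCarriersOfRecord₁₃CoPHCmap (eraseNE3Cmap 𝔯) F θ hP g₀ os k).u3 = (rateCarriersOfRecord₁₃CoPHCmap 𝔯 F θ hP g₀ os k).u3 := rfl

/-- **★ THE N16 CONJUNCT HOLDS OUTRIGHT AT THE ERASED READING.** [folklore] -/
theorem n16HolderAtReadingCmap_eraseNE3 (β : ℝ) : N16HolderAtReadingCmap (eraseNE3Cmap 𝔯) β :=
  fun _ _ _ _ _ _ => n16HolderAt_of_dom_eq_empty rfl β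

/-- **★ THE β-RATES AT THE ERASED READING ARE THE RATES WITH NODE N16 DELETED** (kernel). [folklore] -/
theorem ratesHolderAt_rateCarriersCmap_eraseNE3_iff (D : Datum F N) (β : ℝ) :
    RatesHolderAt D (rateCarriersOfRecord₁₃CoPHCmap (eraseNE3Cmap 𝔯) F θ hP g₀ os k) β ↔
      N14At (rateCarriersOfRecord₁₃CoPHCmap 𝔯 F θ hP g₀ os k).ne1 ∧ N15At (rateCarriersOfRecord₁₃CoPHCmap 𝔯 F θ hP g₀ os k).ne2 ∧
        N17At D (rateCarriersOfRecord₁₃CoPHCmap 𝔯 F θ hP g₀ os k).u3 ∧ N18At (rateCarriersOfRecord₁₃CoPHCmap 𝔯 F θ hP g₀ os k).u3 ∧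
        N22At (rateCarriersOfRecord₁₃CoPHCmap 𝔯 F θ hP g₀ os k).u3 :=
  ⟨fun h => ⟨h.1, h.2.1, h.2.2.2.1, h.2.2.2.2.1, h.2.2.2.2.2⟩,
    fun h => ⟨h.1, h.2.1, n16HolderAtReadingCmap_eraseNE3 𝔯 β F θ hP g₀ os k, h.2.2.1, h.2.2.2.1, h.2.2.2.2⟩⟩

/-- **GIVEN ONE STAGE-13 TUPLE WITH χ-PROVISOS (HYPOTHESIS) THE ERASED READING FAILS THE CONST PIN.** [folklore] -/
theorem not_n16PinnedConstCmap_eraseNE3 (ℓ₃ : T4Family → NE3Letters₁₁) {F : T4Family} (θ : Stage13HParams F N)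
    (hP : θ.Provisos₁₃CoPHChi F N (Χ F θ.toStage13Params)) : ¬ N16PinnedConstCmap (eraseNE3Cmap 𝔯) ℓ₃ := by
  intro h
  have hne : (((eraseNE3Cmap 𝔯).lit F θ hP (fun _ => 0) []).ne3 0).Populated := by
    rw [h F θ hP (fun _ => 0) [] 0]
    exact populated_ne3ConstLayerOfRecord₁₁ F N (ℓ₃ F)
  exact Set.not_nonempty_empty hne

/-- **… AND FAILS THE LOOSE PIN whenever the loose data are non-empty** (displayed). [folklore] -/
theorem not_n16PinnedLooseCmap_eraseNE3_of_nonempty (ℓ₃ : T4Family → NE3Letters₁₁) (B : T4Family → ℝ) {F : T4Family} (θ : Stage13HParams F N)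
    (hP : θ.Provisos₁₃CoPHChi F N (Χ F θ.toStage13Params))
    (hne : ({V | V ∈ ne3DomOfRecord₁₁ F N 0 0 ∧ V ∈ sfClass 4 F.L (ne3NperOfRecord₁₁ F 0 0) ((ℓ₃ F).ε / B F) 0} :
      Set ((Fin 4 → ℤ) → Fin 4 → (MatA N)ˣ)).Nonempty) :
    ¬ N16PinnedLooseCmap (eraseNE3Cmap 𝔯) ℓ₃ B := by
  intro h
  have hne' : (((eraseNE3Cmap 𝔯).lit F θ hP (fun _ => 0) []).ne3 0).Populated := by
    rw [h F θ hP (fun _ => 0) [] 0]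
    exact hne
  exact Set.not_nonempty_empty hne'

end Erase

end Summit.QuantumFields.YangMills.BalabanUVNodes.N16PinnedLayer13CoPH

end
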